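import Literature.Geometry.Symplectic.JHolomorphicMap
import Mathlib.Analysis.Calculus.FDeriv.Symmetric
import Mathlib.Analysis.Calculus.ContDiff.Operations
import Mathlib.Analysis.InnerProductSpace.Calculus
import HarnessLib

/-!
# The Laplacian of a `J`-holomorphic map in flat coordinates and `Δe ≥ -A e²`

Topic `Literature/Geometry/Symplectic` (local analysis of `J`-holomorphic curves, in the flat
vocabulary of `JHolomorphicMap.lean`: `u : ℂ → G` into a real normed / inner product space,
`J : G → L(G)` with `J(x)² = -1`, and the Cauchy–Riemann equation `du(iζ) = J(u) du(ζ)`, i.e.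
`∂_t u = J(u) ∂_s u` with `∂_s = D(·)(1)`, `∂_t = D(·)(i)`). This is the computation behind the
**mean value inequality for `J`-holomorphic curves** (McDuff–Salamon (2012), Lemma 4.3.1): the
energy density `e = |∂_s u|² + |∂_t u|² = |du|²` of a `J`-holomorphic map satisfies the
differential inequality `Δe ≥ -A e²`, to which the Heinz trick
(`Literature/Analysis/PDE/HeinzTrick.lean`, ibid. Lemma 4.3.2) applies.

* `laplacian_eq_of_jHolomorphic_nhds` — **`Δu = DJ(u)[∂_t u] ∂_s u - DJ(u)[∂_s u] ∂_t u`**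
  (`u` of class `C²`, `J` differentiable): differentiate `∂_t u = J(u) ∂_s u` and
  `∂_s u = -J(u) ∂_t u`; the terms `J(u) ∂_s∂_t u` cancel by the symmetry of mixed partials;
  `norm_laplacian_le_of_jHolomorphic_nhds` — hence `|Δu| ≤ ‖DJ(u)‖ e`;
* `fderiv_fderiv_norm_sq_comp_apply`, `laplacianFlat_norm_sq_comp` —
  `Δ|g|² = 2⟨Δg, g⟩ + 2(|∂_s g|² + |∂_t g|²)`; `fderiv_fderiv_fderiv_comm_of_contDiffOn` —
  third-order symmetry `∂ₘ∂ₗ∂ₖ u = ∂ₗ∂ₖ∂ₘ u` for vector-valued `C³` maps;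
  `fderiv_clm_apply_apply`, `norm_fderiv_clm_apply_apply_le` — Leibniz rule for
  `B(y)(p(y), q(y))`;
* `laplacian_energyDensity_ge_of_jHolomorphic` — **`Δe(z) ≥ -(2c₂ + 8c₁²) e(z)²`** for `u` of
  class `C³` on an open `V ∋ z`, `J` of class `C²` at `u z` with `‖DJ(u z)‖ ≤ c₁`,
  `‖D²J(u z)‖ ≤ c₂` (McDuff–Salamon, proof of Lemma 4.3.1: `Δe = 2⟨∂_sΔu, ∂_s u⟩ + 2⟨∂_tΔu, ∂_t u⟩
  + 2|∇du|²`, the derivative of the quadratic expression for `Δu` being absorbed into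
  `2|∇du|²`).

Everything is proved; no definitions, no named facts.

## References

* D. McDuff, D. Salamon, *J-holomorphic Curves and Symplectic Topology*, 2nd ed., AMS
  Colloquium Publ. 52 (2012), §4.3, Lemma 4.3.1 (mean value inequality) and its proof.
  [McDuffSalamon2012]
* C. Hummel, *Gromov's Compactness Theorem for Pseudo-holomorphic Curves* (1997), Ch. I §3,
  eq. (3.1) (the flat Cauchy–Riemann equation). [Hummel1997]
-/

noncomputable section

-- nested operator types `G →L[ℝ] G →L[ℝ] G →L[ℝ] G`
set_option maxSynthPendingDepth 3

open scoped Topology ContDiff RealInnerProductSpace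
open Set Filter Complex

namespace Literature.Geometry.Symplectic

variable {F : Type*} [NormedAddCommGroup F] [NormedSpace ℝ F]

/-- **Symmetry of second partial derivatives** of a vector-valued map `C²` at a point of `ℂ`:
`∂_w ∂_v u = ∂_v ∂_w u`. [folklore] -/
theorem fderiv_partial_comm_of_contDiffAt {u : ℂ → F} {z : ℂ} (hu : ContDiffAt ℝ 2 u z)
    (v w : ℂ) :
    fderiv ℝ (fun y ↦ fderiv ℝ u y v) z w = fderiv ℝ (fun y ↦ fderiv ℝ u y w) z v := by
  have hd : DifferentiableAt ℝ (fderiv ℝ u) z :=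
    (hu.fderiv_right (m := 1) (by norm_num)).differentiableAt one_ne_zero
  rw [fderiv_clm_apply hd (differentiableAt_const v), fderiv_clm_apply hd (differentiableAt_const w)]
  simp only [fderiv_fun_const, Pi.zero_apply, ContinuousLinearMap.comp_zero, zero_add,
    ContinuousLinearMap.flip_apply]
  exact hu.isSymmSndFDerivAt (by simp) w v

/-- **The Laplacian of a `J`-holomorphic map in flat coordinates.** Let `u : ℂ → F` be `C²` at
`z`, `J : F → L(F)` differentiable at `u z`, with `J(u)² = -1` and the flat Cauchy–Riemann
equation `∂_t u = J(u) ∂_s u` (`du(iζ) = J(u) du(ζ)`) near `z`. Then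

  `Δu(z) = ∂_s∂_s u + ∂_t∂_t u = (DJ(u)[∂_t u]) ∂_s u - (DJ(u)[∂_s u]) ∂_t u`

(differentiate `∂_t u = J(u) ∂_s u` in `t` and `∂_s u = -J(u) ∂_t u` in `s`; the terms
`J(u) ∂_t∂_s u` cancel by the symmetry of mixed partials). In particular `Δu` is QUADRATIC in
`du` — the starting point of the elliptic estimates for `J`-curves (McDuff–Salamon (2012),
§4.3, proof of Lemma 4.3.1; App. B). [cite: McDuffSalamon2012, Lemma 4.3.1] -/
theorem laplacian_eq_of_jHolomorphic_nhds {J : F → F →L[ℝ] F} {u : ℂ → F} {z : ℂ}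
    (hu : ContDiffAt ℝ 2 u z) (hJ : DifferentiableAt ℝ J (u z))
    (hJ2 : ∀ᶠ y in 𝓝 z, ∀ v, J (u y) (J (u y) v) = -v)
    (hhol : ∀ᶠ y in 𝓝 z, ∀ ζ : ℂ, fderiv ℝ u y (I * ζ) = J (u y) (fderiv ℝ u y ζ)) :
    fderiv ℝ (fun y ↦ fderiv ℝ u y 1) z 1 + fderiv ℝ (fun y ↦ fderiv ℝ u y I) z I =
      (fderiv ℝ J (u z) (fderiv ℝ u z I)) (fderiv ℝ u z 1) -
        (fderiv ℝ J (u z) (fderiv ℝ u z 1)) (fderiv ℝ u z I) := by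
  -- notation-free abbreviations
  have hud : DifferentiableAt ℝ u z := hu.differentiableAt two_ne_zero
  have hd : DifferentiableAt ℝ (fderiv ℝ u) z :=
    (hu.fderiv_right (m := 1) (by norm_num)).differentiableAt one_ne_zero
  have husd : DifferentiableAt ℝ (fun y ↦ fderiv ℝ u y 1) z := hd.clm_apply (differentiableAt_const _)
  have hutd : DifferentiableAt ℝ (fun y ↦ fderiv ℝ u y I) z := hd.clm_apply (differentiableAt_const _)
  have hJu : DifferentiableAt ℝ (fun y ↦ J (u y)) z := hJ.comp z hud
  have hJu' : fderiv ℝ (fun y ↦ J (u y)) z = (fderiv ℝ J (u z)).comp (fderiv ℝ u z) :=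
    fderiv_comp z hJ hud
  -- the Cauchy–Riemann equation and its `J`-rotated form, near `z`
  have hut : (fun y ↦ fderiv ℝ u y I) =ᶠ[𝓝 z] fun y ↦ J (u y) (fderiv ℝ u y 1) := by
    filter_upwards [hhol] with y hy
    simpa using hy 1
  have hus : (fun y ↦ fderiv ℝ u y 1) =ᶠ[𝓝 z] fun y ↦ -(J (u y) (fderiv ℝ u y I)) := by
    filter_upwards [hhol, hJ2] with y hy hy2
    have h := hy 1
    rw [mul_one] at h
    rw [h, hy2, neg_neg]
  -- differentiate both
  have h1 : fderiv ℝ (fun y ↦ fderiv ℝ u y I) z I =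
      J (u z) (fderiv ℝ (fun y ↦ fderiv ℝ u y 1) z I) +
        (fderiv ℝ J (u z) (fderiv ℝ u z I)) (fderiv ℝ u z 1) := by
    rw [hut.fderiv_eq, fderiv_clm_apply hJu husd, hJu']
    simp only [_root_.add_apply, ContinuousLinearMap.comp_apply, ContinuousLinearMap.flip_apply]
  have h2 : fderiv ℝ (fun y ↦ fderiv ℝ u y 1) z 1 =
      -(J (u z) (fderiv ℝ (fun y ↦ fderiv ℝ u y I) z 1) +
        (fderiv ℝ J (u z) (fderiv ℝ u z 1)) (fderiv ℝ u z I)) := by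
    rw [hus.fderiv_eq, fderiv_fun_neg, fderiv_clm_apply hJu hutd, hJu']
    simp only [_root_.neg_apply, _root_.add_apply, ContinuousLinearMap.comp_apply,
      ContinuousLinearMap.flip_apply]
  rw [h1, h2, fderiv_partial_comm_of_contDiffAt hu 1 I]
  abel

/-- **`|Δu| ≤ |DJ(u)| |du|²` for a `J`-holomorphic map** (flat coordinates): with the energy
density `e = |∂_s u|² + |∂_t u|²`, `‖Δu(z)‖ ≤ ‖DJ(u z)‖ e(z)` (from
`laplacian_eq_of_jHolomorphic_nhds` and `2ab ≤ a² + b²`). McDuff–Salamon (2012), proof of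
Lemma 4.3.1. [cite: McDuffSalamon2012, Lemma 4.3.1] -/
theorem norm_laplacian_le_of_jHolomorphic_nhds {J : F → F →L[ℝ] F} {u : ℂ → F} {z : ℂ}
    (hu : ContDiffAt ℝ 2 u z) (hJ : DifferentiableAt ℝ J (u z))
    (hJ2 : ∀ᶠ y in 𝓝 z, ∀ v, J (u y) (J (u y) v) = -v)
    (hhol : ∀ᶠ y in 𝓝 z, ∀ ζ : ℂ, fderiv ℝ u y (I * ζ) = J (u y) (fderiv ℝ u y ζ)) :
    ‖fderiv ℝ (fun y ↦ fderiv ℝ u y 1) z 1 + fderiv ℝ (fun y ↦ fderiv ℝ u y I) z I‖ ≤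
      ‖fderiv ℝ J (u z)‖ * (‖fderiv ℝ u z 1‖ ^ 2 + ‖fderiv ℝ u z I‖ ^ 2) := by
  rw [laplacian_eq_of_jHolomorphic_nhds hu hJ hJ2 hhol]
  set a := ‖fderiv ℝ u z 1‖
  set b := ‖fderiv ℝ u z I‖
  set N := ‖fderiv ℝ J (u z)‖
  have hN : 0 ≤ N := norm_nonneg (fderiv ℝ J (u z))
  have h1 : ‖(fderiv ℝ J (u z) (fderiv ℝ u z I)) (fderiv ℝ u z 1)‖ ≤ N * b * a :=
    (fderiv ℝ J (u z)).le_opNorm₂ _ _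
  have h2 : ‖(fderiv ℝ J (u z) (fderiv ℝ u z 1)) (fderiv ℝ u z I)‖ ≤ N * a * b :=
    (fderiv ℝ J (u z)).le_opNorm₂ _ _
  calc _ ≤ N * b * a + N * a * b := (norm_sub_le _ _).trans (add_le_add h1 h2)
    _ = N * (2 * a * b) := by ring
    _ ≤ N * (a ^ 2 + b ^ 2) := by
        refine mul_le_mul_of_nonneg_left ?_ hN
        nlinarith [sq_nonneg (a - b)]

/-! ### Second derivatives of `|g|²` and third-order symmetry -/

section Inner

variable {G : Type*} [NormedAddCommGroup G] [InnerProductSpace ℝ G]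

/-- **`D²(|g|²)(z)(h, k) = 2⟨Dg(z)h, Dg(z)k⟩ + 2⟨g(z), D²g(z)(h, k)⟩`** for `g` of class `C²`
near `z`. [folklore] -/
theorem fderiv_fderiv_norm_sq_comp_apply {g : ℂ → G} {z : ℂ} (hg : ContDiffAt ℝ 2 g z)
    (h k : ℂ) :
    fderiv ℝ (fderiv ℝ fun y ↦ ‖g y‖ ^ 2) z h k =
      2 * ⟪fderiv ℝ g z h, fderiv ℝ g z k⟫ + 2 * ⟪g z, fderiv ℝ (fderiv ℝ g) z h k⟫ := by
  have hgd : ∀ᶠ y in 𝓝 z, DifferentiableAt ℝ g y := by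
    filter_upwards [hg.eventually (by simp)] with y hy
    exact hy.differentiableAt two_ne_zero
  have h1 : fderiv ℝ (fun y ↦ ‖g y‖ ^ 2) =ᶠ[𝓝 z]
      fun y ↦ (2 : ℝ) • (innerSL ℝ (g y)).comp (fderiv ℝ g y) := by
    filter_upwards [hgd] with y hy
    rw [hy.hasFDerivAt.norm_sq.fderiv, two_smul, two_smul]
  rw [h1.fderiv_eq]
  have hd : DifferentiableAt ℝ (fderiv ℝ g) z :=
    (hg.fderiv_right (m := 1) (by norm_num)).differentiableAt one_ne_zero
  have hgz : DifferentiableAt ℝ g z := hg.differentiableAt two_ne_zero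
  have hc : HasFDerivAt (fun y ↦ innerSL ℝ (g y))
      ((innerSL ℝ : G →L[ℝ] G →L[ℝ] ℝ).comp (fderiv ℝ g z)) z :=
    (innerSL ℝ : G →L[ℝ] G →L[ℝ] ℝ).hasFDerivAt.comp z hgz.hasFDerivAt
  rw [fderiv_fun_const_smul (hc.differentiableAt.clm_comp hd),
    fderiv_clm_comp hc.differentiableAt hd, hc.fderiv]
  simp only [FunLike.coe_smul, Pi.smul_apply, _root_.add_apply,
    ContinuousLinearMap.comp_apply, ContinuousLinearMap.compL_apply,
    ContinuousLinearMap.flip_apply, innerSL_apply_apply, smul_eq_mul]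
  ring

/-- A partial derivative of a `C³` map on an open set is `C²` there. [folklore] -/
theorem contDiffOn_fderiv_apply_const_of_contDiffOn {u : ℂ → G} {V : Set ℂ} (hV : IsOpen V)
    (hu : ContDiffOn ℝ 3 u V) (v : ℂ) : ContDiffOn ℝ 2 (fun y ↦ fderiv ℝ u y v) V :=
  (hu.fderiv_of_isOpen hV (m := 2) (by norm_num)).clm_apply contDiffOn_const

/-- **Commuting a partial derivative past two others**, vector-valued: for `u` of class `C³` on
an open set, `∂ₘ ∂ₗ ∂ₖ u = ∂ₗ ∂ₖ ∂ₘ u`. [folklore] -/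
theorem fderiv_fderiv_fderiv_comm_of_contDiffOn {u : ℂ → G} {V : Set ℂ} (hV : IsOpen V) {z : ℂ}
    (hz : z ∈ V) (hu : ContDiffOn ℝ 3 u V) (k l m : ℂ) :
    fderiv ℝ (fun y ↦ fderiv ℝ (fun y' ↦ fderiv ℝ u y' k) y l) z m =
      fderiv ℝ (fun y ↦ fderiv ℝ (fun y' ↦ fderiv ℝ u y' m) y k) z l := by
  have hVz : V ∈ 𝓝 z := hV.mem_nhds hz
  have hg : ContDiffAt ℝ 2 (fun y ↦ fderiv ℝ u y k) z :=
    (contDiffOn_fderiv_apply_const_of_contDiffOn hV hu k).contDiffAt hVz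
  rw [fderiv_partial_comm_of_contDiffAt hg l m]
  have hev : (fun y ↦ fderiv ℝ (fun y' ↦ fderiv ℝ u y' k) y m) =ᶠ[𝓝 z]
      fun y ↦ fderiv ℝ (fun y' ↦ fderiv ℝ u y' m) y k := by
    filter_upwards [hVz] with y hy
    exact fderiv_partial_comm_of_contDiffAt
      ((hu.of_le (by norm_num)).contDiffAt (hV.mem_nhds hy)) k m
  rw [hev.fderiv_eq]

/-- **The flat Laplacian of `|g|²`**: `Δ|g|² = 2⟨Δg, g⟩ + 2(|∂_s g|² + |∂_t g|²)` for `g` of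
class `C²` near the point (`∂_s = D(·)(1)`, `∂_t = D(·)(i)`). [folklore] -/
theorem laplacianFlat_norm_sq_comp {g : ℂ → G} {z : ℂ} (hg : ContDiffAt ℝ 2 g z) :
    fderiv ℝ (fderiv ℝ fun y ↦ ‖g y‖ ^ 2) z 1 1 + fderiv ℝ (fderiv ℝ fun y ↦ ‖g y‖ ^ 2) z I I =
      2 * ⟪fderiv ℝ (fun y ↦ fderiv ℝ g y 1) z 1 + fderiv ℝ (fun y ↦ fderiv ℝ g y I) z I, g z⟫ +
        2 * (‖fderiv ℝ g z 1‖ ^ 2 + ‖fderiv ℝ g z I‖ ^ 2) := by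
  have hd : DifferentiableAt ℝ (fderiv ℝ g) z :=
    (hg.fderiv_right (m := 1) (by norm_num)).differentiableAt one_ne_zero
  have happ : ∀ v w : ℂ, fderiv ℝ (fun y ↦ fderiv ℝ g y v) z w = fderiv ℝ (fderiv ℝ g) z w v := by
    intro v w
    rw [fderiv_clm_apply hd (differentiableAt_const v)]
    simp
  rw [fderiv_fderiv_norm_sq_comp_apply hg, fderiv_fderiv_norm_sq_comp_apply hg, happ, happ,
    inner_add_left, real_inner_comm (g z), real_inner_comm (g z), real_inner_self_eq_norm_sq,
    real_inner_self_eq_norm_sq]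
  ring

end Inner

/-! ### Derivative of a bilinear expression `B(y)(p(y), q(y))` -/

section Bilinear

variable {G : Type*} [NormedAddCommGroup G] [NormedSpace ℝ G]

/-- Leibniz rule for `y ↦ B(y)(p(y))(q(y))` with `B(y)` bilinear. [folklore] -/
theorem fderiv_clm_apply_apply {B : ℂ → G →L[ℝ] G →L[ℝ] G} {p q : ℂ → G} {z : ℂ}
    (hB : DifferentiableAt ℝ B z) (hp : DifferentiableAt ℝ p z) (hq : DifferentiableAt ℝ q z)
    (h : ℂ) :
    fderiv ℝ (fun y ↦ B y (p y) (q y)) z h =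
      fderiv ℝ B z h (p z) (q z) + B z (fderiv ℝ p z h) (q z) + B z (p z) (fderiv ℝ q z h) := by
  have hc : DifferentiableAt ℝ (fun y ↦ B y (p y)) z := hB.clm_apply hp
  rw [fderiv_clm_apply hc hq, fderiv_clm_apply hB hp]
  simp only [_root_.add_apply, ContinuousLinearMap.comp_apply, ContinuousLinearMap.flip_apply]
  abel

/-- Norm bound for the Leibniz rule `fderiv_clm_apply_apply`. [folklore] -/
theorem norm_fderiv_clm_apply_apply_le {B : ℂ → G →L[ℝ] G →L[ℝ] G} {p q : ℂ → G} {z : ℂ}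
    (hB : DifferentiableAt ℝ B z) (hp : DifferentiableAt ℝ p z) (hq : DifferentiableAt ℝ q z)
    (h : ℂ) :
    ‖fderiv ℝ (fun y ↦ B y (p y) (q y)) z h‖ ≤
      ‖fderiv ℝ B z h‖ * ‖p z‖ * ‖q z‖ + ‖B z‖ * ‖fderiv ℝ p z h‖ * ‖q z‖ +
        ‖B z‖ * ‖p z‖ * ‖fderiv ℝ q z h‖ := by
  rw [fderiv_clm_apply_apply hB hp hq]
  exact (norm_add₃_le).trans (add_le_add_three ((fderiv ℝ B z h).le_opNorm₂ _ _)
    ((B z).le_opNorm₂ _ _) ((B z).le_opNorm₂ _ _))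

end Bilinear

/-! ### Second derivative of a sum -/

/-- Second derivatives are additive (both summands `C²` at the point). [folklore] -/
theorem fderiv_fderiv_fun_add_apply {φ₁ φ₂ : ℂ → ℝ} {z : ℂ} (h₁ : ContDiffAt ℝ 2 φ₁ z)
    (h₂ : ContDiffAt ℝ 2 φ₂ z) (h k : ℂ) :
    fderiv ℝ (fderiv ℝ fun y ↦ φ₁ y + φ₂ y) z h k =
      fderiv ℝ (fderiv ℝ φ₁) z h k + fderiv ℝ (fderiv ℝ φ₂) z h k := by
  have hev : fderiv ℝ (fun y ↦ φ₁ y + φ₂ y) =ᶠ[𝓝 z] fun y ↦ fderiv ℝ φ₁ y + fderiv ℝ φ₂ y := by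
    filter_upwards [h₁.eventually (by simp), h₂.eventually (by simp)] with y hy₁ hy₂
    exact fderiv_fun_add (hy₁.differentiableAt two_ne_zero) (hy₂.differentiableAt two_ne_zero)
  rw [hev.fderiv_eq, fderiv_fun_add
    ((h₁.fderiv_right (m := 1) (by norm_num)).differentiableAt one_ne_zero)
    ((h₂.fderiv_right (m := 1) (by norm_num)).differentiableAt one_ne_zero)]
  rfl

/-! ### `Δe ≥ -A e²` for the energy density of a `J`-holomorphic map -/

section Energy

variable {G : Type*} [NormedAddCommGroup G] [InnerProductSpace ℝ G]

/-- A quadratic bookkeeping inequality: `0 ≤ 2P² - 4c w P + 2c² e²` when `0 ≤ w ≤ e`.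
[folklore] -/
theorem two_sq_sub_nonneg_aux {P c w e : ℝ} (hw0 : 0 ≤ w) (hwe : w ≤ e) :
    0 ≤ 2 * P ^ 2 - 4 * c * w * P + 2 * c ^ 2 * e ^ 2 := by
  have hw2 : c ^ 2 * w ^ 2 ≤ c ^ 2 * e ^ 2 :=
    mul_le_mul_of_nonneg_left (pow_le_pow_left₀ hw0 hwe 2) (sq_nonneg c)
  nlinarith [sq_nonneg (P - c * w)]
set_option maxHeartbeats 400000 in -- buildfix (bf3-g27): 160k/180k FAIL, 200k PASS at accept time; line-neutral budget line
/-- **The energy density of a `J`-holomorphic map satisfies `Δe ≥ -A e²`** (flat coordinates;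
McDuff–Salamon (2012), proof of Lemma 4.3.1). Let `u : ℂ → G` be of class `C³` on an open
`V ∋ z`, `J : G → L(G)` of class `C²` at `u z`, `J(u)² = -1` and `∂_t u = J(u) ∂_s u` on `V`. If
`‖DJ(u z)‖ ≤ c₁` and `‖D²J(u z)‖ ≤ c₂` then the energy density `e = |∂_s u|² + |∂_t u|²`
satisfies at `z`

  `Δe ≥ -(2 c₂ + 8 c₁²) e²`.

Proof: `Δe = 2⟨Δ∂_s u, ∂_s u⟩ + 2⟨Δ∂_t u, ∂_t u⟩ + 2|∇du|²` (`laplacianFlat_norm_sq_comp`),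
`Δ∂_k u = ∂_k Δu` (symmetry of mixed partials) and `Δu = DJ(u)[∂_t u]∂_s u - DJ(u)[∂_s u]∂_t u`
(`laplacian_eq_of_jHolomorphic_nhds`), whose derivative is bounded by
`2(c₂ |∂_k u| |∂_s u||∂_t u| + c₁ |∂_s u| |∂_k∂_t u| + c₁ |∂_t u| |∂_k∂_s u|)`; absorb the mixed
terms into `2|∇du|²`. [cite: McDuffSalamon2012, Lemma 4.3.1] -/
theorem laplacian_energyDensity_ge_of_jHolomorphic {J : G → G →L[ℝ] G} {u : ℂ → G}
    {V : Set ℂ} (hV : IsOpen V) {z : ℂ} (hz : z ∈ V) (hu : ContDiffOn ℝ 3 u V)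
    (hJ : ContDiffAt ℝ 2 J (u z)) (hJ2 : ∀ y ∈ V, ∀ v, J (u y) (J (u y) v) = -v)
    (hhol : ∀ y ∈ V, ∀ ζ : ℂ, fderiv ℝ u y (I * ζ) = J (u y) (fderiv ℝ u y ζ))
    {c₁ c₂ : ℝ} (hc₁ : ‖fderiv ℝ J (u z)‖ ≤ c₁) (hc₂ : ‖fderiv ℝ (fderiv ℝ J) (u z)‖ ≤ c₂) :
    -((2 * c₂ + 8 * c₁ ^ 2) * (‖fderiv ℝ u z 1‖ ^ 2 + ‖fderiv ℝ u z I‖ ^ 2) ^ 2) ≤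
      fderiv ℝ (fderiv ℝ fun y ↦ ‖fderiv ℝ u y 1‖ ^ 2 + ‖fderiv ℝ u y I‖ ^ 2) z 1 1 +
        fderiv ℝ (fderiv ℝ fun y ↦ ‖fderiv ℝ u y 1‖ ^ 2 + ‖fderiv ℝ u y I‖ ^ 2) z I I := by
  have hVz : V ∈ 𝓝 z := hV.mem_nhds hz
  have hu2 : ∀ y ∈ V, ContDiffAt ℝ 2 u y := fun y hy ↦
    (hu.of_le (by norm_num)).contDiffAt (hV.mem_nhds hy)
  have hu3 : ContDiffAt ℝ 3 u z := hu.contDiffAt hVz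
  have hud : DifferentiableAt ℝ u z := hu3.differentiableAt (by norm_num)
  -- `us = ∂_s u`, `ut = ∂_t u` are `C²`
  have husz : ContDiffAt ℝ 2 (fun y ↦ fderiv ℝ u y 1) z :=
    (contDiffOn_fderiv_apply_const_of_contDiffOn hV hu 1).contDiffAt hVz
  have hutz : ContDiffAt ℝ 2 (fun y ↦ fderiv ℝ u y I) z :=
    (contDiffOn_fderiv_apply_const_of_contDiffOn hV hu I).contDiffAt hVz
  have husd : DifferentiableAt ℝ (fun y ↦ fderiv ℝ u y 1) z := husz.differentiableAt two_ne_zero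
  have hutd : DifferentiableAt ℝ (fun y ↦ fderiv ℝ u y I) z := hutz.differentiableAt two_ne_zero
  have husd2 : ∀ h, DifferentiableAt ℝ (fun y ↦ fderiv ℝ (fun y' ↦ fderiv ℝ u y' 1) y h) z :=
    fun h ↦ ((husz.fderiv_right (m := 1) (by norm_num)).differentiableAt one_ne_zero).clm_apply
      (differentiableAt_const h)
  have hutd2 : ∀ h, DifferentiableAt ℝ (fun y ↦ fderiv ℝ (fun y' ↦ fderiv ℝ u y' I) y h) z :=
    fun h ↦ ((hutz.fderiv_right (m := 1) (by norm_num)).differentiableAt one_ne_zero).clm_apply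
      (differentiableAt_const h)
  -- `J` near `u z`; `B = DJ ∘ u`
  have hJ' : DifferentiableAt ℝ (fderiv ℝ J) (u z) :=
    (hJ.fderiv_right (m := 1) (by norm_num)).differentiableAt one_ne_zero
  have hJd : ∀ᶠ y in 𝓝 z, DifferentiableAt ℝ J (u y) := by
    have h1 : ∀ᶠ x in 𝓝 (u z), ContDiffAt ℝ 2 J x := hJ.eventually (by simp)
    exact (hud.continuousAt.eventually h1).mono fun y hy ↦ hy.differentiableAt two_ne_zero
  have hBd : DifferentiableAt ℝ (fun y ↦ fderiv ℝ J (u y)) z := hJ'.comp z hud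
  have hB' : ∀ h, ‖fderiv ℝ (fun y ↦ fderiv ℝ J (u y)) z h‖ ≤ c₂ * ‖fderiv ℝ u z h‖ := by
    intro h
    rw [show (fun y ↦ fderiv ℝ J (u y)) = fderiv ℝ J ∘ u from rfl, fderiv_comp z hJ' hud,
      ContinuousLinearMap.comp_apply]
    exact ((fderiv ℝ (fderiv ℝ J) (u z)).le_opNorm _).trans
      (mul_le_mul_of_nonneg_right hc₂ (norm_nonneg _))
  -- (i) near `z`: `Δu = Q`
  have hLQ : (fun y ↦ fderiv ℝ (fun y' ↦ fderiv ℝ u y' 1) y 1 +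
      fderiv ℝ (fun y' ↦ fderiv ℝ u y' I) y I) =ᶠ[𝓝 z]
      fun y ↦ fderiv ℝ J (u y) (fderiv ℝ u y I) (fderiv ℝ u y 1) -
        fderiv ℝ J (u y) (fderiv ℝ u y 1) (fderiv ℝ u y I) := by
    filter_upwards [hVz, hJd] with y hy hyJ
    exact laplacian_eq_of_jHolomorphic_nhds (hu2 y hy) hyJ
      (eventually_of_mem (hV.mem_nhds hy) fun y' hy' ↦ hJ2 y' hy')
      (eventually_of_mem (hV.mem_nhds hy) fun y' hy' ↦ hhol y' hy')
  -- mixed partials near `z`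
  have hmix : (fun y ↦ fderiv ℝ (fun y' ↦ fderiv ℝ u y' I) y 1) =ᶠ[𝓝 z]
      fun y ↦ fderiv ℝ (fun y' ↦ fderiv ℝ u y' 1) y I := by
    filter_upwards [hVz] with y hy
    exact (fderiv_partial_comm_of_contDiffAt (hu2 y hy) 1 I).symm
  -- `Δ ∂_s u = ∂_s Q`, `Δ ∂_t u = ∂_t Q`
  have hΔus : fderiv ℝ (fun y ↦ fderiv ℝ (fun y' ↦ fderiv ℝ u y' 1) y 1) z 1 +
      fderiv ℝ (fun y ↦ fderiv ℝ (fun y' ↦ fderiv ℝ u y' 1) y I) z I =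
      fderiv ℝ (fun y ↦ fderiv ℝ J (u y) (fderiv ℝ u y I) (fderiv ℝ u y 1) -
        fderiv ℝ J (u y) (fderiv ℝ u y 1) (fderiv ℝ u y I)) z 1 := by
    rw [← hLQ.fderiv_eq]
    have h1 : fderiv ℝ (fun y ↦ fderiv ℝ (fun y' ↦ fderiv ℝ u y' 1) y I) z I =
        fderiv ℝ (fun y ↦ fderiv ℝ (fun y' ↦ fderiv ℝ u y' I) y I) z 1 := by
      rw [← hmix.fderiv_eq]
      exact fderiv_partial_comm_of_contDiffAt hutz 1 I
    rw [h1, fderiv_fun_add (husd2 1) (hutd2 I)]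
    rfl
  have hΔut : fderiv ℝ (fun y ↦ fderiv ℝ (fun y' ↦ fderiv ℝ u y' I) y 1) z 1 +
      fderiv ℝ (fun y ↦ fderiv ℝ (fun y' ↦ fderiv ℝ u y' I) y I) z I =
      fderiv ℝ (fun y ↦ fderiv ℝ J (u y) (fderiv ℝ u y I) (fderiv ℝ u y 1) -
        fderiv ℝ J (u y) (fderiv ℝ u y 1) (fderiv ℝ u y I)) z I := by
    rw [← hLQ.fderiv_eq]
    have h1 : fderiv ℝ (fun y ↦ fderiv ℝ (fun y' ↦ fderiv ℝ u y' I) y 1) z 1 =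
        fderiv ℝ (fun y ↦ fderiv ℝ (fun y' ↦ fderiv ℝ u y' 1) y 1) z I := by
      rw [hmix.fderiv_eq]
      exact (fderiv_partial_comm_of_contDiffAt husz 1 I).symm
    rw [h1, fderiv_fun_add (husd2 1) (hutd2 I)]
    rfl
  -- the expansion of `Δe`
  have hφ₁ : ContDiffAt ℝ 2 (fun y ↦ ‖fderiv ℝ u y 1‖ ^ 2) z := husz.norm_sq ℝ
  have hφ₂ : ContDiffAt ℝ 2 (fun y ↦ ‖fderiv ℝ u y I‖ ^ 2) z := hutz.norm_sq ℝ
  rw [fderiv_fderiv_fun_add_apply hφ₁ hφ₂, fderiv_fderiv_fun_add_apply hφ₁ hφ₂, add_add_add_comm,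
    laplacianFlat_norm_sq_comp husz, laplacianFlat_norm_sq_comp hutz, hΔus, hΔut]
  -- the bounds on `∂_h Q`
  have hQ : ∀ h, ‖fderiv ℝ (fun y ↦ fderiv ℝ J (u y) (fderiv ℝ u y I) (fderiv ℝ u y 1) -
      fderiv ℝ J (u y) (fderiv ℝ u y 1) (fderiv ℝ u y I)) z h‖ ≤
      2 * (c₂ * ‖fderiv ℝ u z h‖ * ‖fderiv ℝ u z 1‖ * ‖fderiv ℝ u z I‖ +
        c₁ * ‖fderiv ℝ (fun y ↦ fderiv ℝ u y I) z h‖ * ‖fderiv ℝ u z 1‖ +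
        c₁ * ‖fderiv ℝ u z I‖ * ‖fderiv ℝ (fun y ↦ fderiv ℝ u y 1) z h‖) := by
    intro h
    have hf : DifferentiableAt ℝ
        (fun y ↦ fderiv ℝ J (u y) (fderiv ℝ u y I) (fderiv ℝ u y 1)) z :=
      (hBd.clm_apply hutd).clm_apply husd
    have hg : DifferentiableAt ℝ
        (fun y ↦ fderiv ℝ J (u y) (fderiv ℝ u y 1) (fderiv ℝ u y I)) z :=
      (hBd.clm_apply husd).clm_apply hutd
    rw [fderiv_fun_sub hf hg]
    have h1 := norm_fderiv_clm_apply_apply_le hBd hutd husd h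
    have h2 := norm_fderiv_clm_apply_apply_le hBd husd hutd h
    have hB1 := hB' h
    have ha := norm_nonneg (fderiv ℝ u z 1)
    have hb := norm_nonneg (fderiv ℝ u z I)
    have hp1 := norm_nonneg (fderiv ℝ (fun y ↦ fderiv ℝ u y 1) z h)
    have hp2 := norm_nonneg (fderiv ℝ (fun y ↦ fderiv ℝ u y I) z h)
    have hBn := norm_nonneg (fderiv ℝ (fun y ↦ fderiv ℝ J (u y)) z h)
    have hBz := norm_nonneg (fderiv ℝ J (u z))
    calc _ ≤ _ := norm_sub_le _ _
      _ ≤ _ := add_le_add h1 h2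
      _ ≤ _ := by
        nlinarith [mul_le_mul_of_nonneg_right hB1 (mul_nonneg hb ha),
          mul_le_mul_of_nonneg_right hB1 (mul_nonneg ha hb),
          mul_le_mul_of_nonneg_right hc₁ (mul_nonneg hp2 ha),
          mul_le_mul_of_nonneg_right hc₁ (mul_nonneg hb hp1),
          mul_le_mul_of_nonneg_right hc₁ (mul_nonneg hp1 hb),
          mul_le_mul_of_nonneg_right hc₁ (mul_nonneg ha hp2)]
  have hQ1 := hQ 1
  have hQI := hQ I
  -- constants are non-negative
  have hc₁0 : 0 ≤ c₁ := (norm_nonneg _).trans hc₁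
  have hc₂0 : 0 ≤ c₂ := (norm_nonneg _).trans hc₂
  -- abbreviations
  set a := ‖fderiv ℝ u z 1‖ with ha
  set b := ‖fderiv ℝ u z I‖ with hb
  set P₁ := ‖fderiv ℝ (fun y ↦ fderiv ℝ u y 1) z 1‖
  set P₂ := ‖fderiv ℝ (fun y ↦ fderiv ℝ u y 1) z I‖
  set P₃ := ‖fderiv ℝ (fun y ↦ fderiv ℝ u y I) z 1‖
  set P₄ := ‖fderiv ℝ (fun y ↦ fderiv ℝ u y I) z I‖
  set Q₁ := ‖fderiv ℝ (fun y ↦ fderiv ℝ J (u y) (fderiv ℝ u y I) (fderiv ℝ u y 1) -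
      fderiv ℝ J (u y) (fderiv ℝ u y 1) (fderiv ℝ u y I)) z 1‖
  set Q₂ := ‖fderiv ℝ (fun y ↦ fderiv ℝ J (u y) (fderiv ℝ u y I) (fderiv ℝ u y 1) -
      fderiv ℝ J (u y) (fderiv ℝ u y 1) (fderiv ℝ u y I)) z I‖
  have ha0 : 0 ≤ a := norm_nonneg _
  have hb0 : 0 ≤ b := norm_nonneg _
  have hP₁ : 0 ≤ P₁ := norm_nonneg _
  have hP₂ : 0 ≤ P₂ := norm_nonneg _
  have hP₃ : 0 ≤ P₃ := norm_nonneg _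
  have hP₄ : 0 ≤ P₄ := norm_nonneg _
  -- Cauchy–Schwarz for the two inner products
  have hX1 : -(Q₁ * a) ≤ ⟪fderiv ℝ (fun y ↦ fderiv ℝ J (u y) (fderiv ℝ u y I) (fderiv ℝ u y 1) -
      fderiv ℝ J (u y) (fderiv ℝ u y 1) (fderiv ℝ u y I)) z 1, fderiv ℝ u z 1⟫ :=
    (neg_le.1 ((neg_le_abs _).trans (abs_real_inner_le_norm _ _)))
  have hX2 : -(Q₂ * b) ≤ ⟪fderiv ℝ (fun y ↦ fderiv ℝ J (u y) (fderiv ℝ u y I) (fderiv ℝ u y 1) -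
      fderiv ℝ J (u y) (fderiv ℝ u y 1) (fderiv ℝ u y I)) z I, fderiv ℝ u z I⟫ :=
    (neg_le.1 ((neg_le_abs _).trans (abs_real_inner_le_norm _ _)))
  have hQa : Q₁ * a ≤ 2 * (c₂ * a * a * b + c₁ * P₃ * a + c₁ * b * P₁) * a :=
    mul_le_mul_of_nonneg_right hQ1 ha0
  have hQb : Q₂ * b ≤ 2 * (c₂ * b * a * b + c₁ * P₄ * a + c₁ * b * P₂) * b :=
    mul_le_mul_of_nonneg_right hQI hb0
  -- the absorptions
  have he0 : 0 ≤ a ^ 2 + b ^ 2 := by positivity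
  have hab : a * b ≤ a ^ 2 + b ^ 2 := by nlinarith [sq_nonneg (a - b)]
  have haa : a ^ 2 ≤ a ^ 2 + b ^ 2 := by nlinarith
  have hbb : b ^ 2 ≤ a ^ 2 + b ^ 2 := by nlinarith
  have hp0 : 0 ≤ 2 * c₂ * (a ^ 2 + b ^ 2) ^ 2 - 4 * c₂ * a * b * (a ^ 2 + b ^ 2) := by
    have := mul_nonneg (mul_nonneg hc₂0 he0) (sq_nonneg (a - b))
    nlinarith
  have hp1 := two_sq_sub_nonneg_aux (P := P₁) (c := c₁) (mul_nonneg ha0 hb0) hab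
  have hp2 := two_sq_sub_nonneg_aux (P := P₂) (c := c₁) (sq_nonneg b) hbb
  have hp3 := two_sq_sub_nonneg_aux (P := P₃) (c := c₁) (sq_nonneg a) haa
  have hp4 := two_sq_sub_nonneg_aux (P := P₄) (c := c₁) (mul_nonneg ha0 hb0) hab
  linarith [hX1, hX2, hQa, hQb, hp0, hp1, hp2, hp3, hp4]

end Energy

end Literature.Geometry.Symplectic

end
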